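import Literature.Geometry.Lorentzian.HarmonicallyFlatProofs
import Literature.Analysis.FluidPDE.NewtonFarGradPotential
import HarnessLib

/-!
# The gradient of a harmonic conformal factor at infinity: `∇U = -b x/|x|³ + O(|x|⁻³)`

Companion ("Proofs") file of `Literature/Geometry/Lorentzian/HarmonicallyFlat.lean`, second step
(after `HarmonicallyFlatProofs.lean`, which proves Bray's expansion (10)
`U = a + b/|x| + O(|x|⁻²)`, `Bray2001_harmonicFactor_expansion_holds`) on the discharge path of
the named fact `Bray2001_harmonicallyFlatMass_hasADMEnergy` (Bray, J. Differential Geom. 59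
(2001), §2, the sentence after Def. 2: the total mass `2ab` of Def. 2 agrees with the ADM flux
limit (225)). The ADM flux of the harmonically flat chart metric `h = U⁴ δ` is
`∮ -8 U³ ∂ᵣU`, so besides the expansion of `U` one needs the expansion of its *radial
derivative*, `∂ᵣU = -b/|x|² + O(|x|⁻³)` — for harmonic `U` a consequence of (10) (Bray points to
the spherical-harmonics expansion, Folland, *Introduction to PDE*, (2.76)); here it is proved, like
(10) itself, from Green's representation formula:

* `abs_fderiv_newtonKernel_sub_apply_sub_le` — far field of `∇Γ`, `Γ(z) = -(4π|z|)⁻¹`: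
  `|∇Γ(x - y)·w - ∇Γ(x)·w| ≤ 8 |y| |w| / (π |x|³)` for `|y| ≤ S`, `|x| ≥ 2S + 2` (mean value
  inequality with the tree's bound `|D²Γ(z)(a,b)| ≤ |a||b|/(π|z|³)` on the ball `B(x, S+1)`, all
  of whose points have `|z| ≥ |x|/2`);
* `exists_hasHarmonicExpansion_fderiv` — **the gradient expansion**: a function `U` harmonic on
  `{R₁ < |x|} ⊆ ℝ³` with `U → a` at infinity admits `b, C, T` with `U = a + b/|x| + O(|x|⁻²)`
  (`HasHarmonicExpansion U a b`) **and** `|DU(x) w + b ⟨x, w⟩/|x|³| ≤ C |w| / |x|³` for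
  `|x| ≥ T` and all `w`, i.e. `∇U(x) = -b x/|x|³ + O(|x|⁻³)` with the *same* `b`. Proof: as in
  `Bray2001_harmonicFactor_expansion_holds`, `U - a = W = ∫ Γ(· - y) ΔW(y) dy` beyond the cut-off
  radius, with `f = ΔW` continuous and supported in `|y| ≤ R + 2`; for `|x| > R + 4` the kernel
  may be replaced by the smooth bounded-derivative far kernel `Γ∞ = newtonFar 1 2`, so the tree's
  differentiation under the integral (`hasFDerivAt_integral_bddKernel_sub_smul`,
  `NewtonFarGradPotential.lean`) gives `DU(x) w = ∫ ∇Γ(x - y)·w f(y) dy`, and the far field of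
  `∇Γ` gives `DU(x) w - (∫ f) ∇Γ(x)·w = O(|w| |x|⁻³)` with `∇Γ(x)·w = ⟨x, w⟩/(4π|x|³)` and
  `b = -(4π)⁻¹ ∫ f`.

Nothing is defined and no fact is introduced.

## References

* H. L. Bray, *Proof of the Riemannian Penrose inequality using the positive mass theorem*,
  J. Differential Geom. 59 (2001) 177–267, §2, (10), Def. 2 and the remark following it; §13,
  (225).
* G. B. Folland, *Introduction to Partial Differential Equations* (2nd ed.), Prop. 2.75, (2.76).
* D. Gilbarg, N. S. Trudinger, *Elliptic partial differential equations of second order*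
  (2001), (2.13)–(2.14), (2.17).
-/

noncomputable section

open Set Filter Asymptotics Bornology Metric MeasureTheory Topology InnerProductSpace
open scoped Real Laplacian ContDiff RealInnerProductSpace

namespace Literature.Geometry.Lorentzian

open Literature.Analysis.FluidPDE

/-! ### Far field of the gradient of the Newtonian kernel -/

/-- **Far field of `∇Γ`.** For `|y| ≤ S` (`S ≥ 0`) and `|x| ≥ 2S + 2`,
`|∇Γ(x - y)·w - ∇Γ(x)·w| ≤ (8 |w| / (π |x|³)) |y|`: the mean value inequality for
`z ↦ DΓ(z) w` on the ball `B(x, S + 1)`, where `|z| ≥ |x|/2` and hence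
`‖D(DΓ(·) w)(z)‖ ≤ |w|/(π |z|³) ≤ 8|w|/(π|x|³)` (`abs_fderiv_fderiv_newtonKernel_apply_le`).
Gilbarg–Trudinger (2.14) (`|DᵢⱼΓ| ≤ C/|x|ⁿ`). [folklore] -/
theorem abs_fderiv_newtonKernel_sub_apply_sub_le {S : ℝ} (hS : 0 ≤ S) {x y : E3}
    (hx : 2 * S + 2 ≤ ‖x‖) (hy : ‖y‖ ≤ S) (w : E3) :
    |fderiv ℝ newtonKernel (x - y) w - fderiv ℝ newtonKernel x w| ≤
      8 * ‖w‖ / (π * ‖x‖ ^ 3) * ‖y‖ := by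
  set φ : E3 → ℝ := fun z ↦ fderiv ℝ newtonKernel z w with hφ
  have hx0 : 0 < ‖x‖ := by linarith
  have hB : ∀ z ∈ ball x (S + 1), ‖x‖ / 2 ≤ ‖z‖ := by
    intro z hz
    rw [mem_ball_iff_norm] at hz
    have h1 : ‖x‖ - ‖z‖ ≤ ‖x - z‖ := norm_sub_norm_le x z
    rw [← norm_neg (x - z), neg_sub] at h1
    linarith
  have hB0 : ∀ z ∈ ball x (S + 1), z ≠ 0 := by
    intro z hz h
    have := hB z hz
    rw [h, norm_zero] at this
    linarith
  have hdiff : ∀ z ∈ ball x (S + 1), DifferentiableAt ℝ φ z := by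
    intro z hz
    have h1 : ContDiffAt ℝ 1 (fderiv ℝ newtonKernel) z :=
      (contDiffOn_fderiv_newtonKernel (n := 1)).contDiffAt
        (isOpen_compl_singleton.mem_nhds (hB0 z hz))
    exact (h1.differentiableAt one_ne_zero).clm_apply (differentiableAt_const w)
  have hbound : ∀ z ∈ ball x (S + 1), ‖fderiv ℝ φ z‖ ≤ 8 * ‖w‖ / (π * ‖x‖ ^ 3) := by
    intro z hz
    refine ContinuousLinearMap.opNorm_le_bound _ (by positivity) fun v ↦ ?_
    have h := abs_fderiv_fderiv_newtonKernel_apply_le (hB0 z hz) w v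
    have hz2 := hB z hz
    have hz0 : 0 < ‖z‖ := by linarith
    have h8 : ‖x‖ ^ 3 / 8 ≤ ‖z‖ ^ 3 := by
      have := pow_le_pow_left₀ (by positivity) hz2 3
      rw [div_pow] at this
      linarith
    rw [Real.norm_eq_abs]
    calc |fderiv ℝ φ z v| ≤ ‖w‖ * ‖v‖ / (π * ‖z‖ ^ 3) := h
      _ ≤ ‖w‖ * ‖v‖ / (π * (‖x‖ ^ 3 / 8)) :=
          div_le_div_of_nonneg_left (by positivity) (by positivity)
            (mul_le_mul_of_nonneg_left h8 Real.pi_pos.le)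
      _ = 8 * ‖w‖ / (π * ‖x‖ ^ 3) * ‖v‖ := by
          field_simp
  have hxmem : x ∈ ball x (S + 1) := mem_ball_self (by linarith)
  have hymem : x - y ∈ ball x (S + 1) := by
    rw [mem_ball_iff_norm, sub_sub_cancel_left, norm_neg]
    linarith
  have hmvt := (convex_ball x (S + 1)).norm_image_sub_le_of_norm_fderiv_le hdiff hbound
    hxmem hymem
  rw [sub_sub_cancel_left, norm_neg, Real.norm_eq_abs] at hmvt
  exact hmvt

/-! ### The gradient expansion of a harmonic function at infinity -/

/-- **Gradient expansion of a harmonic function tending to a constant at infinity.** If `U` is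
harmonic on `{R₁ < |x|} ⊆ ℝ³` and `U → a` at infinity, then there are `b, C, T` such that
`U = a + b/|x| + O(|x|⁻²)` (`HasHarmonicExpansion U a b`, Bray 2001, (10)) and, with the *same*
`b`, `|DU(x) w + b ⟨x, w⟩/|x|³| ≤ C |w|/|x|³` for all `|x| ≥ T` and all `w ∈ ℝ³` — that is,
`∇U(x) = -b x/|x|³ + O(|x|⁻³)`, in particular `∂ᵣU = -b/|x|² + O(|x|⁻³)` (Folland (2.76);
Bray 2001, §2, used in the remark after Def. 2 and in (225)). Green's representation
(`eq_integral_newtonKernel_mul_laplacian`), differentiation under the integral against the far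
kernel (`hasFDerivAt_integral_bddKernel_sub_smul`) and the far field of `∇Γ`
(`abs_fderiv_newtonKernel_sub_apply_sub_le`). [cite: BrayRPI2001, §2 (10) and Def. 2] -/
theorem exists_hasHarmonicExpansion_fderiv (R₁ : ℝ) (U : E3 → ℝ) (a : ℝ)
    (hU : HarmonicOnNhd U {x : E3 | R₁ < ‖x‖}) (ha : Tendsto U (cobounded E3) (𝓝 a)) :
    ∃ b C T : ℝ, HasHarmonicExpansion U a b ∧ 0 < T ∧ ∀ x : E3, T ≤ ‖x‖ → ∀ w : E3,
      |fderiv ℝ U x w + b * ⟪x, w⟫ / ‖x‖ ^ 3| ≤ C * ‖w‖ / ‖x‖ ^ 3 := by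
  -- an enlarged positive radius
  set R : ℝ := max R₁ 1 with hR_def
  have hR0 : 0 < R := lt_of_lt_of_le one_pos (le_max_right _ _)
  have hR1 : R₁ ≤ R := le_max_left _ _
  -- `V = U - a` is harmonic beyond `R` and tends to `0`
  set V : E3 → ℝ := fun x ↦ U x - a with hV_def
  have hV : ∀ x : E3, R < ‖x‖ → HarmonicAt V x := fun x hx ↦
    (hU x (lt_of_le_of_lt hR1 hx)).sub (harmonicAt_const a)
  have hV0 : Tendsto V (cobounded E3) (𝓝 0) := by
    have := ha.sub_const a
    rwa [sub_self] at this
  -- the cut-off function `W = (1 - θ) V`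
  have h01 : (0 : ℝ) ≤ R + 1 := by linarith
  have h12 : R + 1 < R + 2 := by linarith
  set W : E3 → ℝ := fun x ↦ (1 - radialCutoff (R + 1) (R + 2) x) * V x with hW_def
  have hWV : ∀ x : E3, R + 2 < ‖x‖ → W =ᶠ[𝓝 x] V := fun x hx ↦ by
    filter_upwards [radialCutoff_eventuallyEq_zero (E := E3) h01 h12 hx] with y hy
    simp only [hW_def, hy, sub_zero, one_mul]
  have hW0 : ∀ x : E3, ‖x‖ < R + 1 → W =ᶠ[𝓝 x] fun _ ↦ (0 : ℝ) := fun x hx ↦ by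
    filter_upwards [radialCutoff_eventuallyEq_one (E := E3) h01 h12 hx] with y hy
    simp only [hW_def, hy, sub_self, zero_mul]
  have hW2 : ContDiff ℝ 2 W := by
    refine contDiff_iff_contDiffAt.2 fun x ↦ ?_
    by_cases hx : R < ‖x‖
    · exact ((contDiff_const.sub
        (radialCutoff_contDiff (E' := E3) (R + 1) (R + 2))).contDiffAt).mul (hV x hx).1
    · have hx' := not_lt.1 hx
      exact (contDiffAt_const (c := (0 : ℝ))).congr_of_eventuallyEq (hW0 x (by linarith))
  have hΔW : ∀ x : E3, R + 2 < ‖x‖ → (Δ W) x = 0 := fun x hx ↦ by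
    rw [(laplacian_congr_nhds (hWV x hx)).eq_of_nhds]
    exact (hV x (by linarith)).2.eq_of_nhds
  have hWlim : Tendsto W (cobounded E3) (𝓝 0) := by
    refine hV0.congr' ?_
    filter_upwards [eventually_cobounded_le_norm (R + 2)] with y hy
    show V y = (1 - radialCutoff (R + 1) (R + 2) y) * V y
    rw [radialCutoff_eq_zero h01 h12 hy, sub_zero, one_mul]
  -- Green's representation of `W` and the far field of the Newtonian potential of `f = ΔW`
  have hrep := eq_integral_newtonKernel_mul_laplacian hW2 hΔW hWlim
  set f : E3 → ℝ := Δ W with hf_def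
  have hfc : Continuous f := continuous_laplacian hW2
  have hfcs : HasCompactSupport f := by
    refine HasCompactSupport.intro (isCompact_closedBall (0 : E3) (R + 2)) fun y hy ↦ hΔW y ?_
    rwa [mem_closedBall_zero_iff, not_le] at hy
  have hexp := newtonPotential_sub_isBigO hfc (by linarith : (0 : ℝ) ≤ R + 2) hΔW
  set b : ℝ := -(4 * π)⁻¹ * ∫ y, f y with hb_def
  -- the far kernel `Γ∞ = newtonFar 1 2` and its derivative bound
  set k : E3 → ℝ := newtonFar 1 2 with hk_def
  have hk : ContDiff ℝ 1 k := contDiff_newtonFar one_pos one_lt_two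
  obtain ⟨D, hD⟩ := (exists_bound_newtonFar_derivs (r₀ := (1 : ℝ)) (r₁ := 2) one_pos
    one_lt_two).2.1
  refine ⟨b, 8 * (R + 2) * (∫ y, |f y|) / π, 2 * (R + 2) + 2, ?_, by linarith, ?_⟩
  · -- the expansion (10), as in `Bray2001_harmonicFactor_expansion_holds`
    unfold HasHarmonicExpansion
    refine hexp.congr' ?_ EventuallyEq.rfl
    filter_upwards [eventually_cobounded_le_norm (R + 3)] with x hx
    have hWx : W x = V x := (hWV x (by linarith)).eq_of_nhds
    have hVx : V x = U x - a := rfl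
    rw [← hrep x, hWx, hVx, hb_def]
    ring
  · intro x hx w
    have hx0 : 0 < ‖x‖ := by linarith
    have hx0' : x ≠ 0 := norm_pos_iff.1 hx0
    -- `U = G + a` near `x`, where `G = Γ∞ ⋆ f`
    set G : E3 → ℝ := fun x' ↦ ∫ y, k (x' - y) * f y with hG_def
    have hGΓ : ∀ x' : E3, R + 4 < ‖x'‖ → G x' = ∫ y, newtonKernel (x' - y) * f y := by
      intro x' hx'
      refine integral_congr_ae (Eventually.of_forall fun y ↦ ?_)
      show k (x' - y) * f y = newtonKernel (x' - y) * f y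
      by_cases hy : f y = 0
      · rw [hy, mul_zero, mul_zero]
      · have hyS : ‖y‖ ≤ R + 2 := not_lt.1 fun h ↦ hy (hΔW y h)
        have h2 : (2 : ℝ) ≤ ‖x' - y‖ := by
          have := norm_sub_norm_le x' y
          linarith
        rw [hk_def, newtonFar_eq_newtonKernel zero_le_one one_lt_two h2]
    have hUG : U =ᶠ[𝓝 x] fun x' ↦ G x' + a := by
      filter_upwards [(isOpen_lt continuous_const continuous_norm).mem_nhds
        (show R + 4 < ‖x‖ by linarith)] with x' hx'
      have hWx' : W x' = V x' := (hWV x' (by linarith)).eq_of_nhds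
      have hVx' : V x' = U x' - a := rfl
      rw [hGΓ x' hx', ← hrep x', hWx', hVx']
      ring
    -- differentiate under the integral
    have hfd : fderiv ℝ U x w = ∫ y, (fderiv ℝ k (x - y) w) * f y := by
      rw [hUG.fderiv_eq, fderiv_add_const]
      have := fderiv_integral_bddKernel_sub_smul_apply (F := ℝ) hk hD hfc hfcs x w
      simpa only [smul_eq_mul] using this
    -- replace `∇Γ∞` by `∇Γ` on the support of `f`
    have hpt : ∀ y : E3, (fderiv ℝ k (x - y) w) * f y =
        (fderiv ℝ newtonKernel (x - y) w) * f y := by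
      intro y
      by_cases hy : f y = 0
      · rw [hy, mul_zero, mul_zero]
      · have hyS : ‖y‖ ≤ R + 2 := not_lt.1 fun h ↦ hy (hΔW y h)
        have h2 : (2 : ℝ) < ‖x - y‖ := by
          have := norm_sub_norm_le x y
          linarith
        rw [hk_def, (newtonFar_fderiv_iterates_eq zero_le_one one_lt_two h2).2.1]
    have hint0 : Integrable fun y ↦ (fderiv ℝ k (x - y) w) * f y := by
      refine Continuous.integrable_of_hasCompactSupport ?_ hfcs.mul_left
      exact (((hk.continuous_fderiv one_ne_zero).comp (continuous_const.sub continuous_id)).clm_apply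
        continuous_const).mul hfc
    have hint1 : Integrable fun y ↦ (fderiv ℝ newtonKernel (x - y) w) * f y :=
      hint0.congr (Eventually.of_forall hpt)
    have hint2 : Integrable fun y ↦ (fderiv ℝ newtonKernel x w) * f y :=
      (hfc.integrable_of_hasCompactSupport hfcs).const_mul _
    have hΓx : fderiv ℝ newtonKernel x w = ⟪x, w⟫ / (4 * π * ‖x‖ ^ 3) :=
      fderiv_newtonKernel_apply hx0' w
    have hkey : fderiv ℝ U x w + b * ⟪x, w⟫ / ‖x‖ ^ 3 =
        ∫ y, (fderiv ℝ newtonKernel (x - y) w - fderiv ℝ newtonKernel x w) * f y := by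
      rw [hfd, integral_congr_ae (Eventually.of_forall hpt)]
      simp_rw [sub_mul]
      rw [integral_sub hint1 hint2, integral_const_mul, hΓx, hb_def]
      have hπx : (4 * π * ‖x‖ ^ 3) ≠ 0 := by positivity
      field_simp
      ring
    rw [hkey]
    -- bound the integral
    have hS0 : (0 : ℝ) ≤ R + 2 := by linarith
    have hbd : ∀ y : E3, ‖(fderiv ℝ newtonKernel (x - y) w - fderiv ℝ newtonKernel x w) * f y‖ ≤
        8 * ‖w‖ / (π * ‖x‖ ^ 3) * (R + 2) * |f y| := by
      intro y
      by_cases hy : f y = 0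
      · rw [hy, mul_zero, norm_zero, abs_zero, mul_zero]
      · have hyS : ‖y‖ ≤ R + 2 := not_lt.1 fun h ↦ hy (hΔW y h)
        rw [norm_mul, Real.norm_eq_abs, Real.norm_eq_abs]
        refine mul_le_mul_of_nonneg_right ?_ (abs_nonneg _)
        refine (abs_fderiv_newtonKernel_sub_apply_sub_le hS0 hx hyS w).trans ?_
        exact mul_le_mul_of_nonneg_left hyS (by positivity)
    have hintb : Integrable fun y ↦ 8 * ‖w‖ / (π * ‖x‖ ^ 3) * (R + 2) * |f y| :=
      ((hfc.integrable_of_hasCompactSupport hfcs).abs).const_mul _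
    calc |∫ y, (fderiv ℝ newtonKernel (x - y) w - fderiv ℝ newtonKernel x w) * f y|
        = ‖∫ y, (fderiv ℝ newtonKernel (x - y) w - fderiv ℝ newtonKernel x w) * f y‖ :=
          (Real.norm_eq_abs _).symm
      _ ≤ ∫ y, 8 * ‖w‖ / (π * ‖x‖ ^ 3) * (R + 2) * |f y| :=
          norm_integral_le_of_norm_le hintb (Eventually.of_forall hbd)
      _ = 8 * (R + 2) * (∫ y, |f y|) / π * ‖w‖ / ‖x‖ ^ 3 := by
          rw [integral_const_mul]
          field_simp

end Literature.Geometry.Lorentzian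

end
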